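import Summits.QuantumFields.BalabanUV.Beta.GAN24.WilsonStencilGaugeLeg
import Summits.QuantumFields.BalabanUV.Beta.WilsonReflectionContact

/-!
# `GAN24.WilsonGaugeLegContact` — the TABLE-leg (gauge-leg) Ward law of an2's antisymmetric Wilson table `wilsonA` on `ℤ^(d+1)`, entrywise:
# `Σ_α (wilsonA κ′ u (y − e_α) z (inl α) (inl β) − wilsonA κ′ u y z (inl α) (inl β)) = ½·([u + e_{κ′} = y] − ½([z = y] + [z + e_β = y]))·(d*d δ_{(κ′,u)})_β(z)`

HONEST FRAMING (cell charter, verbatim): «discharging `BetaPertH` makes Bałaban's UV stability UNCONDITIONAL — a real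
constructive-QFT result; it is NOT the continuum limit and NOT the Clay problem.»  DERIVED cell leaf (pub-balaban, G-an2-4
formalisation swarm → CRUX TEAM (2), seat `b2b-balaban-gan24-formalise-leaf-02`, gen 45; stage 3 of CT-ROUTE's step (CT-1) «the TABLE-leg
cubic Ward identity» at the tree's object, toward the row owner's INTERFACE REQUEST G-an2-4 of 2026-08-21T10:11Z): finite algebra, no
estimate, no limit, nothing cited — every statement is kernel-proved ([folklore] = standard finite algebra); no `[cite:]` tag, no
`def … : Prop`; it instantiates NO binder of the β-function wall and discharges NO letter of (CONV-C).  NEVER «G-an2-4 closed»; NOT hSrow,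
NOT D1, NOT `BetaPertH`, NOT continuum, NOT Clay.  «not in print; our bookkeeping».
HONEST DEPENDENCY (cell records, verbatim): «continuum YM on T⁴ ⇐ BetaPertH ∧ nine spine estimates (0/9 proved); BetaPertH ⇐ (D1) ∧
(D4) ∧ CAP+tail; G-an2-4 gates asym, D1 and NE2/3/4.»
ABSOLUTE RULE (cell charter, verbatim): «No internally-minted statement may enter as a cited fact. Every hypothesis is either
kernel-proved in this package or a verbatim quotation of a PUBLISHED theorem with page reference. The manuscript(s) under audit are
NOT citable for their own disputed steps — they are the thing under adjudication; programme-internal (2001/route/tribunal) claims are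
never citable.»

THE STATEMENT (`gaugeLeg_wilsonA_inl_inl`).  For every dimension `d`, every index bond `(κ′, u)`, every varied site `y`, every other table
leg `(z, β)` of `ℤ^(d+1)`:

  **`Σ_α (wilsonA d κ′ u (y − e_α) z (inl α) (inl β) − wilsonA d κ′ u y z (inl α) (inl β))
        = ½ · ([u + e_{κ′} = y] − ½([z = y] + [z + e_β = y])) · curvAdj (curv (delta1 κ′ u)) β z`**

— the response of an2's colourless cubic Wilson stencil `StepJetData.wilsonA` to the pure-gauge FLUCTUATION `d(δ_y)` on its FIRST TABLE LEG is
ONE HALF of the `d*d` (curl–curl) matrix entry between the INDEX bond `(κ′, u)` and the OTHER table leg `(β, z)`, weighted by the TIP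
indicator of the index bond minus the MIDPOINT indicator (average of the two endpoint indicators) of the other leg; the second table leg by
`wilsonA_antisymm` (`gaugeLeg_wilsonA_inl_inl_right`); the multiplier rows vanish (`gaugeLeg_wilsonA_inl_inr`); away from the three contact
sites the sum vanishes (`gaugeLeg_wilsonA_eq_zero`).  Side by side with D1-leaf-05's INDEX-leg law `WilsonDivergenceContact.divV_wilsonA_inl_inl`
(`½ · (d*d δ_{(b,z)})_a(x) · ([z = u] − [x = u])`, SITE indicators): the three pure-gauge laws of the tree's cubic Wilson table on `ℤ^(d+1)`.
WHY THE WEIGHTS DIFFER (context, asserted nowhere below): `wilsonA` is the `(2,1)`-jet of the PRODUCT chart `U_b = e^{W_b}e^{B_b}` (an3); the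
single-chart symmetric cubic would weight every slot by MIDPOINTS; the chart term `½[W_b, B_b]` moves the index-bond weight to the SITE for an
index-leg gauge and to the TIP for a table-leg gauge (`WilsonJetGaugeLeg` header, located INFO I-gan24leaf02-g45-1).

THE PROOF.  (1) `wilsonA`'s field block is an3's antisymmetrised colourless stencil `WilsonReflectionFrame.S₀A` read with the frame
`B6BondElimination.unitVec` (`WilsonReflectionContact.wilsonA_inl_inl`).  (2) The finite-lattice law `WilsonStencilGaugeLeg.S₀A_gaugeLeg_div` is
instantiated on the torus `(ZMod M)^(d+1)` with the reduced frame `castVec M ∘ unitVec` (`torus_law`) and pulled back to `ℤ^(d+1)` along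
`WilsonStencilTransport.castVec (gmod + 1)`, injective on the finite window of sites that occur (`castVec_injOn`, `S₀A_map`, `Lc_map`):
`S₀A_gaugeLeg_div_Z` (D1-leaf-05's `WilsonDivergenceContact.S₀A_div_Z` pattern, with the window `gpts` of this law).  (3) The contact coefficient
is half the `d*d` matrix entry (`WilsonReflectionContact.curvAdj_curv_delta1_eq_two_mul_Lc`).  (4) Paired with a finitely supported gauge function
`ψ` (the summation-by-parts form: leg divergence against `ψ`): **`gaugeLeg_wilsonA_pair`** — `Σ_{y∈S} ψ y · (leg divergence at y) = ½·(ψ(u + e_{κ′}) −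
½(ψ z + ψ(z + e_β)))·(d*d δ_{(κ′,u)})_β(z)` for every `ψ` vanishing off `S`.  NOT HERE: a `comp`∕`conjV`-form packaging of the leg law (the consumer's
currency for CT-3 is not fixed yet).
Provenance: seat b2b-balaban-gan24-formalise-leaf-02 gen 45 (prover-…-leaf-02-g45-0), 2026-08-21; over the files named above BY NAME.
-/

namespace Summit.QuantumFields.BalabanUV.Beta.GAN24.WilsonGaugeLegContact

open Finset
open scoped BigOperators
open Literature.MathematicalPhysics.QuantumFieldTheory.Balaban1983to89
open Literature.MathematicalPhysics.QuantumFieldTheory.Balaban1983to89.Beta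
open PlaquetteStencilData (WilsonIdx wα wβ)
open StepJetData (wilsonA wilsonA_antisymm)
open ExpKernelCalculus (MKer)
open OneStepResolventKernel (Fib)
open AffineAveraging (curv curvAdj)
open KKTFluctuationKernel (delta1)
open B6BondElimination (unitVec unitVec_apply)
open Summit.QuantumFields.BalabanUV.Beta.WilsonReflectionFrame (Lc S₀A)
open Summit.QuantumFields.BalabanUV.Beta.WilsonStencilTransport (castVec castVec_apply castVec_injOn S₀A_map Lc_map)
open Summit.QuantumFields.BalabanUV.Beta.WilsonReflectionContact (wilsonA_inl_inl wilsonA_inl_inr wilsonA_inr_inl wilsonA_inr_inr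
  curvAdj_curv_delta1_eq_two_mul_Lc)
open Summit.QuantumFields.BalabanUV.Beta.GAN24.WilsonStencilGaugeLeg (S₀A_gaugeLeg_div)

noncomputable section

variable {d : ℕ}

/-! ## §1 The torus instance of the finite-lattice law -/

section Torus

/-- [folklore] THE TORUS LAW: `WilsonStencilGaugeLeg.S₀A_gaugeLeg_div` on `(ZMod M)^(d+1)` with the reduced frame `castVec M ∘ unitVec`. -/
theorem torus_law (M : ℕ) [NeZero M] (y u : Fin (d + 1) → ZMod M) (κ' : Fin (d + 1)) (q : (Fin (d + 1) → ZMod M) × Fin (d + 1)) :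
    (∑ κ, (S₀A (⇑(castVec M) ∘ unitVec) u κ' (y - (⇑(castVec M) ∘ unitVec) κ, κ) q - S₀A (⇑(castVec M) ∘ unitVec) u κ' (y, κ) q)) =
      ((if u + (⇑(castVec M) ∘ unitVec) κ' = y then 1 else 0)
        - ((if q.1 = y then 1 else 0) + (if q.1 + (⇑(castVec M) ∘ unitVec) q.2 = y then 1 else 0)) / 2) *
        Lc (⇑(castVec M) ∘ unitVec) q.2 q.1 (u, κ') :=
  S₀A_gaugeLeg_div _ y u κ' q

end Torus

/-! ## §2 The finite window of sites and the transfer to `ℤ^(d+1)` -/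

section Transfer

/-- index type of the finite family of sites entering the transfer.  A definition asserting nothing. [folklore] -/
abbrev GIdx (d : ℕ) : Type :=
  (Fin 5 ⊕ (Fin (d + 1) × (Bool ⊕ WilsonIdx (Fin (d + 1))) ⊕ Fin (d + 1) × WilsonIdx (Fin (d + 1))))
    ⊕ ((Fin (d + 1) × Fin (d + 1)) ⊕ (Bool × Fin (d + 1)))

/-- THE FINITE FAMILY OF SITES entering the transfer of the law for the index bond `(u, κ′)`, the varied leg site `y`, the other leg
`(z, β)`: the sites `u`, `y`, `z`, `u + e_{κ′}`, `z + e_β`; the shifted leg sites `y − e_κ`; the stencil supports `u + wα i`, `u + wβ i`;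
and the sites `z − e_ν + e_μ`, `z − e_ν`, `z + e_μ` read by the contact coefficient.  A definition asserting nothing. [folklore] -/
def gpts (u y z : Fin (d + 1) → ℤ) (κ' β : Fin (d + 1)) : GIdx d → (Fin (d + 1) → ℤ)
  | Sum.inl (Sum.inl i) =>
      match i with
      | ⟨0, _⟩ => u
      | ⟨1, _⟩ => y
      | ⟨2, _⟩ => z
      | ⟨3, _⟩ => u + unitVec κ'
      | _ => z + unitVec β
  | Sum.inl (Sum.inr (Sum.inl (κ, Sum.inl _))) => y - unitVec κ
  | Sum.inl (Sum.inr (Sum.inl (_, Sum.inr i))) => u + wα unitVec κ' i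
  | Sum.inl (Sum.inr (Sum.inr (_, i))) => u + wβ unitVec κ' i
  | Sum.inr (Sum.inl νμ) => z - unitVec νμ.1 + unitVec νμ.2
  | Sum.inr (Sum.inr (true, ν)) => z - unitVec ν
  | Sum.inr (Sum.inr (false, μ)) => z + unitVec μ

/-- THE MODULUS of the transfer torus: the sum of all coordinate differences of the family (one is added when used).  A definition asserting
nothing. [folklore] -/
def gmod (u y z : Fin (d + 1) → ℤ) (κ' β : Fin (d + 1)) : ℕ :=
  ∑ i, ∑ i', ∑ j, (gpts u y z κ' β i j - gpts u y z κ' β i' j).natAbs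

/-- **THE GAUGE-LEG (TABLE-LEG WARD) LAW OF THE ANTISYMMETRISED COLOURLESS WILSON STENCIL ON `ℤ^(d+1)`** (frame `B6BondElimination.unitVec`):
`Σ_κ (S₀A(u, κ′; (y − e_κ, κ), (z,β)) − S₀A(u, κ′; (y, κ), (z,β))) = ([u + e_{κ′} = y] − ½([z = y] + [z + e_β = y])) · Lc unitVec β z (u, κ′)` —
the torus law pulled back along `castVec (gmod + 1)`. [folklore] -/
theorem S₀A_gaugeLeg_div_Z (u y z : Fin (d + 1) → ℤ) (κ' β : Fin (d + 1)) :
    (∑ κ, (S₀A unitVec u κ' (y - unitVec κ, κ) (z, β) - S₀A unitVec u κ' (y, κ) (z, β))) =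
      ((if u + unitVec κ' = y then 1 else 0) - ((if z = y then 1 else 0) + (if z + unitVec β = y then 1 else 0)) / 2) *
        Lc unitVec β z (u, κ') := by
  have hS : Set.InjOn (castVec (gmod u y z κ' β + 1)) (Set.range (gpts u y z κ' β)) := castVec_injOn (gpts u y z κ' β)
  have key := torus_law (gmod u y z κ' β + 1) (castVec _ y) (castVec _ u) κ' (castVec _ z, β)
  dsimp only at key
  have mu : u ∈ Set.range (gpts u y z κ' β) := ⟨Sum.inl (Sum.inl 0), rfl⟩
  have my : y ∈ Set.range (gpts u y z κ' β) := ⟨Sum.inl (Sum.inl 1), rfl⟩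
  have mz : z ∈ Set.range (gpts u y z κ' β) := ⟨Sum.inl (Sum.inl 2), rfl⟩
  have muk : u + unitVec κ' ∈ Set.range (gpts u y z κ' β) := ⟨Sum.inl (Sum.inl 3), rfl⟩
  have mzb : z + unitVec β ∈ Set.range (gpts u y z κ' β) := ⟨Sum.inl (Sum.inl 4), rfl⟩
  have myk : ∀ κ, y - unitVec κ ∈ Set.range (gpts u y z κ' β) := fun κ => ⟨Sum.inl (Sum.inr (Sum.inl (κ, Sum.inl true))), rfl⟩
  have mα : ∀ i, u + wα unitVec κ' i ∈ Set.range (gpts u y z κ' β) := fun i => ⟨Sum.inl (Sum.inr (Sum.inl (κ', Sum.inr i))), rfl⟩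
  have mβ : ∀ i, u + wβ unitVec κ' i ∈ Set.range (gpts u y z κ' β) := fun i => ⟨Sum.inl (Sum.inr (Sum.inr (κ', i))), rfl⟩
  have m₃ : ∀ ν μ, z - unitVec ν + unitVec μ ∈ Set.range (gpts u y z κ' β) := fun ν μ => ⟨Sum.inr (Sum.inl (ν, μ)), rfl⟩
  have m₁ : ∀ ν, z - unitVec ν ∈ Set.range (gpts u y z κ' β) := fun ν => ⟨Sum.inr (Sum.inr (true, ν)), rfl⟩
  have m₂ : ∀ μ, z + unitVec μ ∈ Set.range (gpts u y z κ' β) := fun μ => ⟨Sum.inr (Sum.inr (false, μ)), rfl⟩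
  have hsub : ∀ κ, castVec (gmod u y z κ' β + 1) y - (⇑(castVec (gmod u y z κ' β + 1)) ∘ unitVec) κ =
      castVec (gmod u y z κ' β + 1) (y - unitVec κ) := fun κ => by rw [Function.comp_apply, map_sub]
  have hadd : ∀ (w : Fin (d + 1) → ℤ) (κ : Fin (d + 1)), castVec (gmod u y z κ' β + 1) w + (⇑(castVec (gmod u y z κ' β + 1)) ∘ unitVec) κ =
      castVec (gmod u y z κ' β + 1) (w + unitVec κ) := fun w κ => by rw [Function.comp_apply, map_add]
  have hκ : ∀ κ, S₀A (⇑(castVec (gmod u y z κ' β + 1)) ∘ unitVec) (castVec (gmod u y z κ' β + 1) u) κ'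
      (castVec (gmod u y z κ' β + 1) (y - unitVec κ), κ) (castVec (gmod u y z κ' β + 1) z, β) = S₀A unitVec u κ' (y - unitVec κ, κ) (z, β) :=
    fun κ => S₀A_map _ hS unitVec u κ' (myk κ) mz mα mβ κ β
  have hκ' : ∀ κ, S₀A (⇑(castVec (gmod u y z κ' β + 1)) ∘ unitVec) (castVec (gmod u y z κ' β + 1) u) κ'
      (castVec (gmod u y z κ' β + 1) y, κ) (castVec (gmod u y z κ' β + 1) z, β) = S₀A unitVec u κ' (y, κ) (z, β) :=
    fun κ => S₀A_map _ hS unitVec u κ' my mz mα mβ κ β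
  simp only [hsub, hadd, hκ, hκ', Lc_map _ hS unitVec β z u κ' mu mz m₁ m₂ m₃, hS.eq_iff muk my, hS.eq_iff mz my, hS.eq_iff mzb my] at key
  exact key

end Transfer

/-! ## §3 The law for an2's `wilsonA`, entrywise -/

section Law

/-- [folklore] **THE FIELD–FIELD ENTRY OF THE GAUGE-LEG LAW FOR `wilsonA`** (the first table leg carries the pure gauge `grad δ_y`):
`Σ_α (wilsonA κ′ u (y − e_α) z (inl α) (inl β) − wilsonA κ′ u y z (inl α) (inl β))
   = ½ · ([u + e_{κ′} = y] − ½([z = y] + [z + e_β = y])) · (d*d δ_{(κ′,u)})_β(z)` — TIP on the index bond, MIDPOINT on the other leg, against the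
curl–curl (`curvAdj ∘ curv`) contact between the index bond and the other leg. -/
theorem gaugeLeg_wilsonA_inl_inl (κ' : Fin (d + 1)) (u y z : Fin (d + 1) → ℤ) (β : Fin (d + 1)) :
    (∑ α, (wilsonA d κ' u (y - unitVec α) z (Sum.inl α) (Sum.inl β) - wilsonA d κ' u y z (Sum.inl α) (Sum.inl β))) =
      (1 / 2 : ℝ) * ((if u + unitVec κ' = y then 1 else 0) - ((if z = y then 1 else 0) + (if z + unitVec β = y then 1 else 0)) / 2) *
        curvAdj (curv (delta1 κ' u)) β z := by
  simp only [wilsonA_inl_inl]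
  rw [S₀A_gaugeLeg_div_Z, curvAdj_curv_delta1_eq_two_mul_Lc]
  ring

/-- [folklore] **THE SECOND TABLE LEG** (by `wilsonA_antisymm`): `Σ_β (wilsonA κ′ u x (y − e_β) (inl α) (inl β) − wilsonA κ′ u x y (inl α) (inl β))
   = −½ · ([u + e_{κ′} = y] − ½([x = y] + [x + e_α = y])) · (d*d δ_{(κ′,u)})_α(x)`. -/
theorem gaugeLeg_wilsonA_inl_inl_right (κ' : Fin (d + 1)) (u x y : Fin (d + 1) → ℤ) (α : Fin (d + 1)) :
    (∑ β, (wilsonA d κ' u x (y - unitVec β) (Sum.inl α) (Sum.inl β) - wilsonA d κ' u x y (Sum.inl α) (Sum.inl β))) =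
      -((1 / 2 : ℝ) * ((if u + unitVec κ' = y then 1 else 0) - ((if x = y then 1 else 0) + (if x + unitVec α = y then 1 else 0)) / 2) *
        curvAdj (curv (delta1 κ' u)) α x) := by
  rw [← gaugeLeg_wilsonA_inl_inl κ' u y x α, ← Finset.sum_neg_distrib]
  refine Finset.sum_congr rfl fun β _ => ?_
  rw [wilsonA_antisymm κ' u (y - unitVec β) x (Sum.inl β) (Sum.inl α), wilsonA_antisymm κ' u y x (Sum.inl β) (Sum.inl α)]
  ring

/-- [folklore] the law's multiplier rows vanish (a table leg on the multiplier block sees no Wilson table). -/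
theorem gaugeLeg_wilsonA_inl_inr (κ' : Fin (d + 1)) (u y z : Fin (d + 1) → ℤ) (b : Fin (d + 1)) :
    (∑ α, (wilsonA d κ' u (y - unitVec α) z (Sum.inl α) (Sum.inr b) - wilsonA d κ' u y z (Sum.inl α) (Sum.inr b))) = 0 := by
  simp only [wilsonA_inl_inr, sub_self, Finset.sum_const_zero]

/-- [folklore] **AWAY FROM THE CONTACT SITES THE GAUGE LEG IS INVISIBLE**: if `y` is neither the tip of the index bond nor an endpoint of the
other leg, the gauge-leg sum vanishes. -/
theorem gaugeLeg_wilsonA_eq_zero {κ' : Fin (d + 1)} {u y z : Fin (d + 1) → ℤ} {β : Fin (d + 1)} (hu : u + unitVec κ' ≠ y) (hz : z ≠ y)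
    (hzb : z + unitVec β ≠ y) :
    (∑ α, (wilsonA d κ' u (y - unitVec α) z (Sum.inl α) (Sum.inl β) - wilsonA d κ' u y z (Sum.inl α) (Sum.inl β))) = 0 := by
  rw [gaugeLeg_wilsonA_inl_inl, if_neg hu, if_neg hz, if_neg hzb]
  ring


/-- [folklore] **THE GAUGE-LEG LAW PAIRED WITH A FINITELY SUPPORTED GAUGE FUNCTION** (the summation-by-parts form a consumer uses: pairing the
leg divergence with `ψ` = minus pairing the table leg with `dψ`): for every `ψ` vanishing off a finite set `S`,
`Σ_{y ∈ S} ψ y · Σ_α (wilsonA κ′ u (y − e_α) z (inl α) (inl β) − wilsonA κ′ u y z (inl α) (inl β))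
   = ½ · (ψ(u + e_{κ′}) − ½(ψ z + ψ(z + e_β))) · (d*d δ_{(κ′,u)})_β(z)` — TIP value on the index bond minus MIDPOINT value on the other leg. -/
theorem gaugeLeg_wilsonA_pair (κ' : Fin (d + 1)) (u z : Fin (d + 1) → ℤ) (β : Fin (d + 1)) (ψ : (Fin (d + 1) → ℤ) → ℝ)
    (S : Finset (Fin (d + 1) → ℤ)) (hψ : ∀ y ∉ S, ψ y = 0) :
    (∑ y ∈ S, ψ y * ∑ α, (wilsonA d κ' u (y - unitVec α) z (Sum.inl α) (Sum.inl β) - wilsonA d κ' u y z (Sum.inl α) (Sum.inl β))) =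
      (1 / 2 : ℝ) * (ψ (u + unitVec κ') - (ψ z + ψ (z + unitVec β)) / 2) * curvAdj (curv (delta1 κ' u)) β z := by
  have key : ∀ a : Fin (d + 1) → ℤ, (∑ y ∈ S, ψ y * (if a = y then (1 : ℝ) else 0)) = ψ a := by
    intro a
    have h : ∀ y ∈ S, ψ y * (if a = y then (1 : ℝ) else 0) = if a = y then ψ y else 0 := by
      intro y _; split_ifs <;> simp
    rw [Finset.sum_congr rfl h, Finset.sum_ite_eq]
    split_ifs with ha
    · rfl
    · exact (hψ a ha).symm
  simp only [gaugeLeg_wilsonA_inl_inl]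
  have e : ∀ y ∈ S, ψ y * ((1 / 2 : ℝ) * ((if u + unitVec κ' = y then 1 else 0) -
      ((if z = y then 1 else 0) + (if z + unitVec β = y then 1 else 0)) / 2) * curvAdj (curv (delta1 κ' u)) β z) =
      (1 / 2 : ℝ) * curvAdj (curv (delta1 κ' u)) β z * (ψ y * (if u + unitVec κ' = y then 1 else 0)) -
        (1 / 4 : ℝ) * curvAdj (curv (delta1 κ' u)) β z * (ψ y * (if z = y then 1 else 0)) -
        (1 / 4 : ℝ) * curvAdj (curv (delta1 κ' u)) β z * (ψ y * (if z + unitVec β = y then 1 else 0)) := by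
    intro y _; ring
  rw [Finset.sum_congr rfl e, Finset.sum_sub_distrib, Finset.sum_sub_distrib, ← Finset.mul_sum, ← Finset.mul_sum, ← Finset.mul_sum,
    key, key, key]
  ring

end Law

end

end Summit.QuantumFields.BalabanUV.Beta.GAN24.WilsonGaugeLegContact
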